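/-
Copyright (c) 2026 the pub-hodgecm-mathlib formalisation cell (harness21).  Prover seat hodgecm-mathlib-K2E1-p15 (g3), Track B ∕ K2-LIT, h413 = `stmt-HodgeConjecture-24833`,
R90-TF section S8 «ContSpec-n½» (planner R90-CS-plan (g0), hand «p09» of S8-R7 2026-09-04T15:54:26Z, the generic glue row R6 of the ROAD memo `R90/S8/ROAD-S8B2.K2E1-p13-g3.md`):
an irreducible closed subrepresentation inside the closed span of a family of blocks is unitarily equivalent to an irreducible piece of ONE block.
-/
import Summits.HodgeConjecture.HodgeConjecture.Theorems.R90S8UnitarySchurDichotomy   -- ★ p861493 (this seat): #7 `isOrtho_or_equiv_of_isTopIrreducible`; brings ★ `HilbertRepSpectrum(Proofs)`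
import HarnessLib

/-!
# S8 «p09» — `R90S8IrreducibleMeetsOneBlock`: an irreducible closed subrepresentation `P ≤ closure (⨆ᵢ Bᵢ)` of a unitary representation is unitarily equivalent to an
# irreducible closed subrepresentation of some block `Bᵢ`

Track B ∕ K2-LIT, crux h413 = `stmt-HodgeConjecture-24833`, route of record `HCCMUnconditional`; cell `hodgecm-mathlib`, R90-TF programme, section S8 «ContSpec-n½»
(§13.9 residual spectrum), generic glue R6 for the #2∕#4 classification road (an irreducible `P ≤ L²_res = closure (⊕ residue blocks)` must meet one block).  THEOREMS ONLY
(no `def`, no `instance`, no `notation`, no named-fact hypothesis, no `sorry`; default heartbeats); lane `--supports stmt-HodgeConjecture-24833 --as helper` (count-neutral).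

THE MATHEMATICS ([Dixmier1977, §5.4, §13.1]; [DeitmarEchterhoff2014, Cor. 6.1.9]).  Let `π` be unitary on the Hilbert space `H`, `(Bᵢ)ᵢ` ANY family of closed invariant
subspaces (pairwise orthogonality is NOT needed and not assumed) and `P` a topologically irreducible closed invariant subspace with `P ≤ closure (Σᵢ Bᵢ)`.  If `P ⟂ Bᵢ`
for every `i`, then `Σᵢ Bᵢ ≤ Pᗮ` (Mathlib `Submodule.isOrtho_iSup_right`), and `Pᗮ` is closed (`Submodule.isClosed_orthogonal`), so `closure (Σᵢ Bᵢ) ≤ Pᗮ`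
(`Submodule.topologicalClosure_minimal`); with `P ≤ closure (Σᵢ Bᵢ)` this gives `P ⟂ P`, i.e. `P = 0` (`Submodule.isOrtho_self`) — impossible, an irreducible
representation lives on a non-trivial space (★ `isTopIrreducible_iff`).  Hence `P ⊥̸ Bᵢ` for some `i`, and the unitary Schur dichotomy (★ #7
`isOrtho_or_equiv_of_isTopIrreducible`, this seat's `R90S8UnitarySchurDichotomy`) yields an irreducible closed `P′ ≤ Bᵢ` unitarily equivalent to `P`.
* §1 **`exists_le_block_equiv_of_le_topologicalClosure_iSup`** — THE HEAD («p09»).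
HONEST LABEL: HC_CM is proved only modulo the 7 printed citations (2 remaining named inputs: hLiu418 = `stmt-HodgeConjecture-24832`, h413 = `stmt-HodgeConjecture-24833`) until
rung 0 closes; this file asserts no named fact and closes no socket; count-neutral.

## References
* [Dixmier1977] J. Dixmier, *C\*-algebras* (North-Holland, 1977), §5.4, §13.1.
* [DeitmarEchterhoff2014] A. Deitmar, S. Echterhoff, *Principles of Harmonic Analysis*, 2nd ed. (Springer, 2014), Cor. 6.1.9.
-/

set_option autoImplicit false
set_option linter.dupNamespace false  -- the mandated namespace `…HodgeConjecture.HodgeConjecture.R90.S8` (LEAD #1 L1) repeats the summit's segment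

noncomputable section

namespace Summit.HodgeConjecture.HodgeConjecture.R90.S8

open ContRepresentation

variable {G H : Type*} [Group G] [NormedAddCommGroup H] [InnerProductSpace ℂ H] [CompleteSpace H]
  {π : ContRepresentation ℂ G H}

/-! ## §1 The head: an irreducible inside the closed span of blocks meets one block -/

/-- **«p09» — an irreducible closed subrepresentation inside `closure (⨆ᵢ Bᵢ)` is unitarily equivalent to an irreducible closed subrepresentation of some block `Bᵢ`.**
For `π` unitary, ANY family `B : ι → ClosedSubrep π` (no orthogonality assumed) and `P` topologically irreducible with `P ≤ (⨆ i, Bᵢ).topologicalClosure`: some `i`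
and some irreducible closed `P′ ≤ B i` with `P ≃ᵤ P′`.  If `P ⟂ B i` for all `i` then `closure (⨆ Bᵢ) ≤ Pᗮ` (closedness of `Pᗮ`), so `P ⟂ P`, `P = ⊥`,
contradicting ★ `isTopIrreducible_iff` (non-trivial carrier); otherwise ★ #7 `isOrtho_or_equiv_of_isTopIrreducible` at that block.
[cite: Dixmier1977, §5.4, §13.1] [cite: DeitmarEchterhoff2014, Cor. 6.1.9] -/
theorem exists_le_block_equiv_of_le_topologicalClosure_iSup (hπ : π.IsUnitary) {ι : Type*} (B : ι → ClosedSubrep π)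
    (P : ClosedSubrep π) (hP : P.toContRep.IsTopIrreducible)
    (hle : P.toSubmodule ≤ (⨆ i, (B i).toSubmodule).topologicalClosure) :
    ∃ (i : ι) (P' : ClosedSubrep π), P' ≤ B i ∧ P'.toContRep.IsTopIrreducible ∧
      AreUnitarilyEquivalent P.toContRep P'.toContRep := by
  -- some block is NOT orthogonal to `P`
  have hex : ∃ i, ¬ P.toSubmodule ⟂ (B i).toSubmodule := by
    by_contra hall
    push Not at hall
    -- then `⨆ Bᵢ ≤ Pᗮ`, hence its closure too (`Pᗮ` is closed), hence `P ⟂ P`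
    have h1 : (⨆ i, (B i).toSubmodule) ≤ P.toSubmoduleᗮ := (Submodule.isOrtho_iSup_right.mpr hall).ge
    have h2 : (⨆ i, (B i).toSubmodule).topologicalClosure ≤ P.toSubmoduleᗮ :=
      Submodule.topologicalClosure_minimal _ h1 (Submodule.isClosed_orthogonal _)
    have h3 : P.toSubmodule ⟂ P.toSubmodule := Submodule.isOrtho_iff_le.mpr (hle.trans h2)
    have hbot : P.toSubmodule = ⊥ := Submodule.isOrtho_self.mp h3
    -- but an irreducible representation has a non-trivial carrier
    have hnt : Nontrivial P.toSubmodule := ((isTopIrreducible_iff _).mp hP).1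
    obtain ⟨v, hv⟩ := exists_ne (0 : P.toSubmodule)
    apply hv
    apply Subtype.ext
    have hv0 : (v : H) ∈ (⊥ : Submodule ℂ H) := hbot ▸ v.2
    simpa using hv0
  obtain ⟨i, hi⟩ := hex
  rcases isOrtho_or_equiv_of_isTopIrreducible hπ (B i) P hP with h | ⟨P', hP'le, hP'irr, hequiv⟩
  · exact absurd h hi
  · exact ⟨i, P', hP'le, hP'irr, hequiv⟩

end Summit.HodgeConjecture.HodgeConjecture.R90.S8

end
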